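import Summits.ValiantsHypothesis.ValiantsHypothesis.Theorems.VPBoundarySquareDegree
import HarnessLib

/-!
# VPBoundarySquare — the DEGREE FORMAT of border families is the unconditional shadow of U_CH
(decomp-valiant lens 3, NODE v9, theorem T4, third file)

Bookkeeping that makes «T4 is a consequence of U_CH (`CHClosureDefinable`, item 24721) proved
unconditionally» a pair of theorems with IDENTICAL conclusions, exactly as T1 did for the
transcendence degree (`isVPBarFamily_coeff_trdeg_le'` vs `coeff_trdeg_le_of_chClosureDefinable`):

* `degreeBound_of_chClosureDefinable` : U_CH ⟹ for every `\overline{VP}` p-family `f` there is a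
  p-bounded `B` with `∏ i, δ i ≤ (2^{B n} · Σ_i (δ i − 1) + 1)^{B n}` whenever the power products
  `∏ i, (coeff_{c i} f_n)^{j i}` (`j i < δ i`) are `ℚ`-linearly independent — because `f_n = Q_n(x, κ_n)`
  with `deg Q_n ≤ 2^{p(n)}` (exponential format) and `p(n)` constants, and the power products of the
  coefficient polynomials of `Q_n` in the constants are too few (`degreeMethod_of_spec`, the plain
  — closure-free — degree method `prod_le_of_linearIndependent_aeval`).
* `isVPBarFamily_degreeBound` : the SAME conclusion with NO hypothesis, from the border degree method
  `degreeMethod_of_approxComplexity_le` of `VPBoundarySquareDegree`.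

So of U_CH's FORMAT clause (coefficients `= Q_n(κ_n)`, `Q_n` integer of degree and height `2^{poly}`,
`poly` constants) the degree part costs nothing; what remains is the height/exp-format compression and
the `CH/poly`-definability of `Q_n` (critic ruling R4). Honest scope: implications and an unconditional
restriction theorem; nothing here proves U_CH, `\overline{VP} ⊆ VPSPACE`, or bears on `VP ≠ VNP`.
0 sorry. Sources: Bürgisser–Clausen–Shokrollahi 1997 Thm. (9.3) [corpus chunk p0246]; Bürgisser 2026
Def. 4.1–4.2 (exponential format, `VCH⁰`) [corpus paper-arxiv-2606.25121 p0011].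
-/

noncomputable section

set_option linter.dupNamespace false

open MvPolynomial
open Literature.Computability.AlgebraicComplexity

namespace Summit.ValiantsHypothesis.ValiantsHypothesis.Theorems.VPBoundarySquareDegreeFormat

open Summit.ValiantsHypothesis.ValiantsHypothesis.Theses.VPBoundarySquare
open Summit.ValiantsHypothesis.ValiantsHypothesis.Theorems.VPBoundarySquareTrdeg
open Summit.ValiantsHypothesis.ValiantsHypothesis.Theorems.VPBoundarySquareDegree

/-! ### The plain degree method: too many power products of low-degree polynomials are dependent -/

/-- **Counting core of the degree method.** If `H_i ∈ ℚ[y_P]` have degree `≤ D` and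
`∏ i, δ i > (D · Σ_i (δ i − 1) + 1)^{#P}`, the power products `∏ i, H_i^{j i}` (`j i < δ i`) satisfy a
nontrivial rational linear relation. [cite: BurgisserClausenShokrollahi1997, Thm. (9.3) (§9.1, proof)] -/
theorem exists_rel_powerProducts {P ι : Type} [Fintype P] [Fintype ι] [DecidableEq ι]
    (H : ι → MvPolynomial P ℚ) {D : ℕ}
    (hdeg : ∀ i, (H i).totalDegree ≤ D) (δ : ι → ℕ)
    (hlt : (D * ∑ i, (δ i - 1) + 1) ^ Fintype.card P < ∏ i, δ i) :
    ∃ a : (∀ i, Fin (δ i)) → ℚ, (∃ j, a j ≠ 0) ∧ ∑ j, a j • ∏ i, H i ^ ((j i : ℕ)) = 0 := by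
  classical
  set T := D * ∑ i, (δ i - 1) with hT
  let Pj : (∀ i, Fin (δ i)) → MvPolynomial P ℚ := fun j => ∏ i, H i ^ (j i : ℕ)
  have hdegP : ∀ j, (Pj j).totalDegree ≤ T := by
    intro j
    refine (totalDegree_finsetProd _ _).trans ?_
    calc ∑ i, (H i ^ (j i : ℕ)).totalDegree
        ≤ ∑ i, (δ i - 1) * D := Finset.sum_le_sum fun i _ => (totalDegree_pow _ _).trans
            (Nat.mul_le_mul (Nat.le_sub_one_of_lt (j i).2) (hdeg i))
      _ = T := by rw [hT, ← Finset.sum_mul, mul_comm]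
  let E : Type := P → Fin (T + 1)
  let toF : E → (P →₀ ℕ) := fun g => Finsupp.equivFunOnFinite.symm fun p => (g p : ℕ)
  let Λ : MvPolynomial P ℚ →ₗ[ℚ] (E → ℚ) :=
    { toFun := fun q g => coeff (toF g) q
      map_add' := fun q q' => by funext g; simp
      map_smul' := fun a q => by funext g; simp [coeff_smul] }
  have hΛ : ∀ q : MvPolynomial P ℚ, q.totalDegree ≤ T → Λ q = 0 → q = 0 := by
    intro q hq h0
    ext e
    rw [coeff_zero]
    by_cases he : e ∈ q.support
    · have hle : ∀ p, e p ≤ T := by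
        intro p
        refine le_trans ?_ ((le_totalDegree he).trans hq)
        by_cases hp : p ∈ e.support
        · exact Finset.single_le_sum (fun _ _ => Nat.zero_le _) hp
        · rw [Finsupp.notMem_support_iff.mp hp]; exact Nat.zero_le _
      have : toF (fun p => ⟨e p, Nat.lt_succ_of_le (hle p)⟩) = e := by
        ext p; simp [toF]
      have h1 := congrFun h0 (fun p => ⟨e p, Nat.lt_succ_of_le (hle p)⟩)
      simpa [Λ, this] using h1
    · exact notMem_support_iff.mp he
  have hdep : ¬ LinearIndependent ℚ (fun j => Λ (Pj j)) := by
    intro hli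
    have h := hli.fintype_card_le_finrank
    rw [Module.finrank_fintype_fun_eq_card, Fintype.card_pi] at h
    simp only [Fintype.card_fin, E, Fintype.card_fun] at h
    exact absurd h (not_le.mpr hlt)
  obtain ⟨a, ha0, j₀, hj₀⟩ := Fintype.not_linearIndependent_iff.mp hdep
  refine ⟨a, ⟨j₀, hj₀⟩, hΛ _ ?_ ?_⟩
  · refine (totalDegree_finsetSum _ _).trans (Finset.sup_le fun j _ => ?_)
    exact (totalDegree_smul_le _ _).trans (hdegP j)
  · rw [map_sum]
    simpa only [map_smul] using ha0

/-- **The plain degree method**: values `H_i(y)` of polynomials of degree `≤ D` in `#P` variables at ANY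
point of ANY `ℚ`-algebra admit at most `(D · Σ_i (δ i − 1) + 1)^{#P}` linearly independent power
products with exponents `< δ`. [cite: BurgisserClausenShokrollahi1997, Thm. (9.3) (§9.1)] -/
theorem prod_le_of_linearIndependent_aeval {P ι : Type} [Fintype P] [Fintype ι] (H : ι → MvPolynomial P ℚ)
    {D : ℕ} (hdeg : ∀ i, (H i).totalDegree ≤ D) {A : Type} [CommRing A] [Algebra ℚ A] (y : P → A)
    (δ : ι → ℕ) (hind : LinearIndependent ℚ fun j : (∀ i, Fin (δ i)) => ∏ i, aeval y (H i) ^ ((j i : ℕ))) :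
    ∏ i, δ i ≤ (D * ∑ i, (δ i - 1) + 1) ^ Fintype.card P := by
  classical
  by_contra hlt
  push Not at hlt
  obtain ⟨a, ⟨j₀, hj₀⟩, hrel⟩ := exists_rel_powerProducts H hdeg δ hlt
  have key := congrArg (aeval y) hrel
  simp only [map_sum, map_smul, map_prod, map_pow, map_zero] at key
  exact hj₀ (Fintype.linearIndependent_iff.mp hind a key j₀)

/-! ### The coefficient polynomials of a specialisation `Q(x, κ)` and their degrees -/

/-- The generic specialisation over `ℚ`: `Q'(x, y)` viewed in `(ℚ[y_w])[x_v]`.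
[cite: Burgisser2026HNC, Def. 4.2 (p. 11)] -/
def specGenQ {v w : ℕ} (Q' : MvPolynomial (Fin (v + w)) ℚ) : MvPolynomial (Fin v) (MvPolynomial (Fin w) ℚ) :=
  aeval (Fin.append (fun i => (X i : MvPolynomial (Fin v) (MvPolynomial (Fin w) ℚ))) fun j => C (X j)) Q'

/-- `specGen` over `ℤ` mapped to `ℚ` is `specGenQ` of the mapped polynomial. [folklore] -/
theorem map_specGen {v w : ℕ} (Q : MvPolynomial (Fin (v + w)) ℤ) :
    MvPolynomial.map (MvPolynomial.map (Int.castRingHom ℚ)) (specGen Q) =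
      specGenQ (MvPolynomial.map (Int.castRingHom ℚ) Q) := by
  have key : (MvPolynomial.map (σ := Fin v) (MvPolynomial.map (σ := Fin w) (Int.castRingHom ℚ))).comp
        (aeval (R := ℤ) (S₁ := MvPolynomial (Fin v) (MvPolynomial (Fin w) ℤ))
          (Fin.append (fun i => X i) fun j => C (X j))).toRingHom =
      (aeval (R := ℚ) (S₁ := MvPolynomial (Fin v) (MvPolynomial (Fin w) ℚ))
          (Fin.append (fun i => X i) fun j => C (X j))).toRingHom.comp
        (MvPolynomial.map (Int.castRingHom ℚ)) := by
    refine MvPolynomial.ringHom_ext (fun r => by simp) fun i => ?_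
    induction i using Fin.addCases with
    | left i => simp [Fin.append_left]
    | right j => simp [Fin.append_right]
  exact congrArg (fun φ : MvPolynomial (Fin (v + w)) ℤ →+* MvPolynomial (Fin v) (MvPolynomial (Fin w) ℚ) =>
    φ Q) key

/-- Mapping along the injection `ℤ → ℚ` preserves total degree. [folklore] -/
theorem totalDegree_map_intCast {n : ℕ} (Q : MvPolynomial (Fin n) ℤ) :
    (MvPolynomial.map (Int.castRingHom ℚ) Q).totalDegree = Q.totalDegree := by
  rw [totalDegree, totalDegree, support_map_of_injective _ (RingHom.injective_int _)]

/-- **The coefficient polynomials of `Q(x, y)` in the constants `y` have degree `≤ deg Q`.**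
[cite: Burgisser2026HNC, Def. 4.1 (p. 11)] -/
theorem totalDegree_coeff_specGen_le {v w : ℕ} (Q : MvPolynomial (Fin (v + w)) ℤ) (d : Fin v →₀ ℕ) :
    (MvPolynomial.map (Int.castRingHom ℚ) (coeff d (specGen Q))).totalDegree ≤ Q.totalDegree := by
  rw [← coeff_map, map_specGen, ← totalDegree_map_intCast Q]
  refine cdeg_aeval (σ := Fin v) (P := Fin w) _ (fun i => ?_) _ d
  induction i using Fin.addCases with
  | left i =>
    intro e
    rw [Fin.append_left]
    exact (cdeg_X (P := Fin w) i e).trans (Nat.zero_le _)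
  | right j =>
    intro e
    rw [Fin.append_right]
    exact (cdeg_C (σ := Fin v) (X j : MvPolynomial (Fin w) ℚ) e).trans (totalDegree_X _).le

/-- **DEGREE METHOD for specialisations `f = Q(x, κ)`**: the power products of the coefficients of `f`
with exponents `< δ` admit at most `(deg Q · Σ_i (δ i − 1) + 1)^{w}` linearly independent members over
`ℚ` (`w` = number of constants). [cite: BurgisserClausenShokrollahi1997, Thm. (9.3) (§9.1)]
[cite: Burgisser2026HNC, Def. 4.2 (p. 11)] -/
theorem degreeMethod_of_spec {v w : ℕ} (Q : MvPolynomial (Fin (v + w)) ℤ) (κ : Fin w → ℂ)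
    {f : MvPolynomial (Fin v) ℂ}
    (hf : f = aeval (Fin.append X fun j => C (κ j)) (MvPolynomial.map (Int.castRingHom ℂ) Q))
    {ι : Type} [Fintype ι] (c : ι → (Fin v →₀ ℕ)) (δ : ι → ℕ)
    (hind : LinearIndependent ℚ fun j : (∀ i, Fin (δ i)) => ∏ i, coeff (c i) f ^ ((j i : ℕ))) :
    ∏ i, δ i ≤ (Q.totalDegree * ∑ i, (δ i - 1) + 1) ^ w := by
  let H : ι → MvPolynomial (Fin w) ℚ := fun i => MvPolynomial.map (Int.castRingHom ℚ) (coeff (c i) (specGen Q))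
  have hcoef : ∀ i, coeff (c i) f = aeval κ (H i) := by
    intro i
    simp only [H]
    rw [hf, spec_eq_map_specGen, coeff_map, aeval_map_intCast]
  have hfun : (fun j : (∀ i, Fin (δ i)) => ∏ i, coeff (c i) f ^ ((j i : ℕ))) =
      fun j => ∏ i, aeval κ (H i) ^ ((j i : ℕ)) := by
    funext j
    exact Finset.prod_congr rfl fun i _ => by rw [hcoef i]
  rw [hfun] at hind
  have h := prod_le_of_linearIndependent_aeval H (D := Q.totalDegree)
    (fun i => totalDegree_coeff_specGen_le Q (c i)) κ δ hind
  simpa only [Fintype.card_fin] using h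

/-! ### U_CH-side and unconditional family-level degree bounds, with identical conclusions -/

/-- **U_CH ⟹ the degree format of border families** (`CHClosureDefinable`, item 24721, gives
`f_n = Q_n(x, κ_n)` with `Q` of exponential format: `deg Q_n ≤ 2^{p(n)}`, `#κ_n ≤ p(n)`).
[cite: Burgisser2026HNC, Def. 4.1–4.2 (p. 11)] [cite: BurgisserClausenShokrollahi1997, Thm. (9.3) (§9.1)] -/
theorem degreeBound_of_chClosureDefinable (hU : CHClosureDefinable) {v : ℕ → ℕ}
    {f : ∀ n, MvPolynomial (Fin (v n)) ℂ} (hpf : IsPFamily f) (hbar : IsVPBarFamily f) :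
    ∃ B : ℕ → ℕ, IsPBounded B ∧ ∀ n, ∀ {ι : Type} [Fintype ι] (c : ι → (Fin (v n) →₀ ℕ)) (δ : ι → ℕ),
      LinearIndependent ℚ (fun j : (∀ i, Fin (δ i)) => ∏ i, coeff (c i) (f n) ^ ((j i : ℕ))) →
        ∏ i, δ i ≤ (2 ^ B n * ∑ i, (δ i - 1) + 1) ^ B n := by
  obtain ⟨w, Q, κ, hQ, hf⟩ := hU v f hpf hbar
  obtain ⟨p, hp, hfmt⟩ := hQ.isExpFormat
  refine ⟨p, hp, fun n ι _ c δ hind => ?_⟩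
  have hw : w n ≤ p n := (Nat.le_add_left _ _).trans (hfmt n).1
  refine (degreeMethod_of_spec (Q n) (κ n) (hf n) c δ hind).trans ?_
  refine (Nat.pow_le_pow_left (Nat.add_le_add_right (Nat.mul_le_mul_right _ (hfmt n).2.1) 1) _).trans ?_
  exact Nat.pow_le_pow_right (Nat.succ_pos _) hw

/-- **The degree format of border families, UNCONDITIONALLY** — the same conclusion as
`degreeBound_of_chClosureDefinable` with no hypothesis, by the border degree method
(`degreeMethod_of_approxComplexity_le`). [cite: BurgisserClausenShokrollahi1997, Thm. (9.3) (§9.1)]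
[cite: BurgisserEtAl2011, Def. 9.3.1] -/
theorem isVPBarFamily_degreeBound {v : ℕ → ℕ} {f : ∀ n, MvPolynomial (Fin (v n)) ℂ}
    (hpf : IsPFamily f) (hbar : IsVPBarFamily f) :
    ∃ B : ℕ → ℕ, IsPBounded B ∧ ∀ n, ∀ {ι : Type} [Fintype ι] (c : ι → (Fin (v n) →₀ ℕ)) (δ : ι → ℕ),
      LinearIndependent ℚ (fun j : (∀ i, Fin (δ i)) => ∏ i, coeff (c i) (f n) ^ ((j i : ℕ))) →
        ∏ i, δ i ≤ (2 ^ B n * ∑ i, (δ i - 1) + 1) ^ B n := by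
  have hv : IsPBounded v := by simpa using hpf.1
  set r : ℕ → ℕ := fun n => approxComplexity (f n) with hr
  have hrb : IsPBounded r := hbar
  let a : ℕ → ℕ := fun n => 2 * ((v n + 2 * r n + 1) * (8 * (v n + 2 * r n + 1) + 1))
  let B : ℕ → ℕ := fun n => a n + paramCount (v n) (r n)
  have hN : IsPBounded fun n => v n + 2 * r n + 1 :=
    IsPBounded.add_holds (IsPBounded.add_holds hv (IsPBounded.mul_holds (IsPBounded.const 2) hrb))
      (IsPBounded.const 1)
  have ha : IsPBounded a := IsPBounded.mul_holds (IsPBounded.const 2) (IsPBounded.mul_holds hN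
    (IsPBounded.add_holds (IsPBounded.mul_holds (IsPBounded.const 8) hN) (IsPBounded.const 1)))
  have hpc : IsPBounded fun n => paramCount (v n) (r n) := by
    have hN1 : IsPBounded fun n => v n + 2 * r n + 1 + 1 := IsPBounded.add_holds hN (IsPBounded.const 1)
    have h2N : IsPBounded fun n => 2 * (v n + 2 * r n + 1) + 1 :=
      IsPBounded.add_holds (IsPBounded.mul_holds (IsPBounded.const 2) hN) (IsPBounded.const 1)
    exact IsPBounded.mul_holds
      (IsPBounded.add_holds hN1 (IsPBounded.mul_holds (IsPBounded.mul_holds hN1 h2N) (IsPBounded.const 2)))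
      (IsPBounded.add_holds hv (IsPBounded.const 1))
  refine ⟨B, IsPBounded.add_holds ha hpc, fun n ι _ c δ hind => ?_⟩
  classical
  have h := degreeMethod_of_approxComplexity_le (f n) (le_refl (r n)) c δ hind
  simp only [Fintype.card_fin] at h
  refine h.trans ((Nat.pow_le_pow_left (Nat.add_le_add_right (Nat.mul_le_mul_right _
    (Nat.pow_le_pow_right two_pos (Nat.le_add_right _ _))) 1) _).trans
    (Nat.pow_le_pow_right (Nat.succ_pos _) (Nat.le_add_left _ _)))

end Summit.ValiantsHypothesis.ValiantsHypothesis.Theorems.VPBoundarySquareDegreeFormat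

end
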